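import Literature.InformationTheory.QuantumCodes.ToricCodeErasureHalfLaw
import Literature.InformationTheory.QuantumCodes.ToricCodeLatticeConverses
import Literature.Probability.Percolation.KestenTheoremProofs
import HarnessLib

/-!
# The loss threshold of the toric code is EXACTLY `1/2` (Stace–Barrett–Doherty 2009), from Kesten's theorem

Topic `Literature/InformationTheory/QuantumCodes` (venture QEC, LADDER-QEC rung Q5; qec-type-03). All PROVED, no named fact,
kernel axioms. Third file of the toric-loss / bond-percolation dictionary (`ToricCodeErasureHalfGeometry.lean`: an
uncorrectable loss pattern produces a one-arm event `{0 ↔ ∂B(n)}` in the lift around some site; `ToricCodeErasureHalfLaw.lean`: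
the lifted loss law on a box is bond percolation, `P_p[uncorrectable] ≤ L² P_p(0 ↔ ∂B(n))`):

* **`erasureThreshold_half : IsThresholdLowerBound erasureFamily (1/2)`** — with Kesten's theorem in the tree's PROVED form
  `Kesten1980_expDecay` (`p < 1/2 ⇒ P_p(0 ↔ ∂B(n) in B(n)) ≤ e^{-cn}`: Kesten 1980 Thm. 2 (1.7), assembled in
  `KestenTheoremProofs.lean` from Duminil-Copin–Tassion sharpness and `p_c(ℤ²) = 1/2`):
  `P_y[loss pattern of the (L+1) × (L+1) toric code uncorrectable] ≤ (L+1)² e^{-c⌊L/2⌋} → 0` for every loss rate `y < 1/2`;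
* **`erasure_accuracyThreshold_eq_half : accuracyThreshold erasureFamily = 1/2`** — together with the no-cloning ceiling
  `erasure_threshold_le_half` (`ToricCodeLatticeConverses.lean`, qec-lit-2) the loss threshold of the toric code is EXACTLY
  `1/2`: Stace–Barrett–Doherty's "sharp boundary … corresponding to the bond percolation threshold on the square lattice: for
  `p_loss < 0.5` loss recovery almost surely succeeds, whereas for `p_loss > 0.5` loss recovery almost surely fails" — the
  supercritical half being `tendsto_erasureFamily_one` (`1/2 < y ≤ 1 ⇒ P_y[uncorrectable] → 1`);
* decoder forms: `erasureDecoderThreshold_half` (EVERY family of consistent loss decoders — maximum likelihood, peeling —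
  succeeds w.h.p. below `1/2`), `erasureDecoder_threshold_le_half` (NO loss-decoder family has a threshold lower bound above
  `1/2`), `erasureDecoder_accuracyThreshold_eq_half` (consistent families: EXACTLY `1/2`).

Both sectors of the toric code have the same loss behaviour (`uncorrectableProb_dual`, lattice self-duality), so the
statements cover `X`- and `Z`-losses alike. This is the first EXACT threshold value among the QEC cell's certified
threshold rows (all others are certified intervals).

## References

* [StaceBarrettDoherty2009] T. M. Stace, S. D. Barrett, A. C. Doherty, *Thresholds for topological codes in the
  presence of loss*, PRL 102 (2009) 200501, arXiv:0904.3556, p. 1 (abstract: "the maximum tolerable loss rate is 50%"),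
  p. 2–3 (sharp boundary at the bond percolation threshold `0.5`).
* [KestenCMP1980] H. Kesten, *The critical probability of bond percolation on the square lattice equals 1/2*,
  Comm. Math. Phys. 74 (1980) 41–59, Thm. 1, Thm. 2 (1.7).
* [DelfosseZemor2020] N. Delfosse, G. Zémor, PRR 2 (2020) 033042, §2 (ML / peeling loss decoding; Lemma 1).
-/

namespace Literature.InformationTheory.QuantumCodes

namespace ToricCode

open Finset Matrix Filter Topology
open Literature.Probability.LatticeModels (Site box zdGraph)
open Literature.Probability.Percolation (siteToBoundary bondPercolation Kesten1980_expDecay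
  tendsto_const_mul_sq_mul_exp_neg)

variable {L : ℕ}

/-! ### The loss threshold of the toric code is exactly `1/2` -/

/-- **The toric-code loss threshold is at least `1/2`** (Stace–Barrett–Doherty: "for `p_loss < 0.5` loss recovery almost
surely succeeds"): for every loss rate `0 ≤ y < 1/2`, `P_y[loss pattern of the (L+1) × (L+1) toric code uncorrectable]
≤ (L+1)² e^{-c⌊L/2⌋} → 0`, with Kesten's exponential decay of the one-arm probability below `p_c(ℤ²) = 1/2`
(`Kesten1980_expDecay`, PROVED in the tree). [cite: StaceBarrettDoherty2009, p. 2–3; KestenCMP1980, Thm. 2 (1.7)] -/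
theorem erasureThreshold_half : IsThresholdLowerBound erasureFamily (1 / 2) := by
  intro y hy0 hy
  have hy1 : y ≤ 1 := by linarith
  set p : unitInterval := ⟨y, hy0, hy1⟩ with hp
  obtain ⟨c, hc, hdec⟩ := Kesten1980_expDecay p (by simpa [hp] using hy)
  -- the finite-size bound for `L + 1 ≥ 3`
  have hbound : ∀ L : ℕ, 2 ≤ L →
      erasureFamily L y ≤ ((L + 1 : ℕ) : ℝ) ^ 2 * Real.exp (-c * (L / 2 : ℕ)) := by
    intro L hL2
    have h := uncorrectableProb_le_sq_mul_real_siteToBoundary (L := L + 1) (by omega) (n := L / 2) (by omega) p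
    refine h.trans ?_
    exact mul_le_mul_of_nonneg_left (hdec _) (by positivity)
  have hnonneg : ∀ L : ℕ, 0 ≤ erasureFamily L y := fun L =>
    ErasureDecoder.uncorrectableProb_nonneg _ _ hy0 hy1
  -- `(L+1)² e^{-c⌊L/2⌋} ≤ e^{c/2} (L+1)² e^{-(c/2)((L+1)-1)} → 0`
  have hc2 : 0 < c / 2 := by linarith
  have hdom : ∀ L : ℕ, ((L + 1 : ℕ) : ℝ) ^ 2 * Real.exp (-c * (L / 2 : ℕ)) ≤
      Real.exp (c / 2) * ((L + 1 : ℕ) : ℝ) ^ 2 * Real.exp (-(c / 2 * ((((L + 1 : ℕ) : ℝ)) - 1))) := by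
    intro L
    have hfloor : ((L : ℝ) - 1) / 2 ≤ ((L / 2 : ℕ) : ℝ) := by
      have h1 : (L : ℝ) - 1 ≤ 2 * ((L / 2 : ℕ) : ℝ) := by
        have : L - 1 ≤ 2 * (L / 2) := by omega
        have : ((L - 1 : ℕ) : ℝ) ≤ ((2 * (L / 2) : ℕ) : ℝ) := by exact_mod_cast this
        rcases Nat.eq_zero_or_pos L with h0 | hpos
        · subst h0; simp
        · rw [Nat.cast_sub hpos] at this
          push_cast at this
          linarith
      linarith
    have hexp : Real.exp (-c * (L / 2 : ℕ)) ≤ Real.exp (c / 2) * Real.exp (-(c / 2 * ((((L + 1 : ℕ) : ℝ)) - 1))) := by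
      rw [← Real.exp_add]
      apply Real.exp_le_exp.2
      push_cast
      nlinarith
    calc ((L + 1 : ℕ) : ℝ) ^ 2 * Real.exp (-c * (L / 2 : ℕ))
        ≤ ((L + 1 : ℕ) : ℝ) ^ 2 * (Real.exp (c / 2) * Real.exp (-(c / 2 * ((((L + 1 : ℕ) : ℝ)) - 1)))) :=
          mul_le_mul_of_nonneg_left hexp (by positivity)
      _ = _ := by ring
  have hlim : Tendsto (fun L : ℕ => Real.exp (c / 2) * ((L + 1 : ℕ) : ℝ) ^ 2 *
      Real.exp (-(c / 2 * ((((L + 1 : ℕ) : ℝ)) - 1)))) atTop (𝓝 0) :=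
    (Filter.tendsto_add_atTop_iff_nat 1).2 (tendsto_const_mul_sq_mul_exp_neg (Real.exp (c / 2)) (c / 2) hc2)
  refine squeeze_zero' (Filter.Eventually.of_forall hnonneg) ?_
    (squeeze_zero' (Filter.Eventually.of_forall fun L => ?_) (Filter.Eventually.of_forall hdom) hlim)
  · rw [Filter.eventually_atTop]
    exact ⟨2, fun L hL => hbound L hL⟩
  · positivity

/-- **THE LOSS THRESHOLD OF THE TORIC CODE IS EXACTLY `1/2`** (Stace–Barrett–Doherty 2009: "the maximum tolerable loss
rate is 50%", "a sharp boundary … corresponding to the bond percolation threshold on the square lattice"): the accuracy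
threshold of the loss-uncorrectability family of the toric codes — the supremum of the certified loss-threshold lower
bounds — equals `1/2`. Floor: `erasureThreshold_half` (Kesten's theorem); ceiling: the no-cloning dichotomy
`erasure_threshold_le_half` (`ToricCodeLatticeConverses.lean`). [cite: StaceBarrettDoherty2009, p. 1 (abstract), p. 2–3] -/
theorem erasure_accuracyThreshold_eq_half : accuracyThreshold erasureFamily = 1 / 2 :=
  le_antisymm (erasure_threshold_le_half (isThresholdLowerBound_accuracyThreshold _))
    (le_accuracyThreshold erasureThreshold_half (by norm_num))

open Classical in
/-- **Above `1/2` loss recovery almost surely fails** (Stace–Barrett–Doherty: "whereas for `p_loss > 0.5` loss recovery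
almost surely fails"): for `1/2 < y ≤ 1`, `P_y[loss pattern uncorrectable] → 1` — by the no-cloning identity
`1 ≤ P_y + P_{1-y}` (both sectors alike, `uncorrectableProb_dual`) and `P_{1-y} → 0` (`erasureThreshold_half`).
[cite: StaceBarrettDoherty2009, p. 3] -/
theorem tendsto_erasureFamily_one {y : ℝ} (hy : 1 / 2 < y) (hy1 : y ≤ 1) :
    Tendsto (fun L => erasureFamily L y) atTop (𝓝 1) := by
  have hy0 : 0 ≤ y := by linarith
  have hlow : ∀ L : ℕ, 1 - erasureFamily L (1 - y) ≤ erasureFamily L y := by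
    intro L
    have h := (toricCode (L + 1)).one_le_uncorrectableProb_add toricCode_k_pos (y := y) hy0 hy1
    rw [uncorrectableProb_dual] at h
    change 1 ≤ erasureFamily L y + erasureFamily L (1 - y) at h
    linarith
  have hup : ∀ L : ℕ, erasureFamily L y ≤ 1 := fun L => by
    unfold erasureFamily ErasureDecoder.uncorrectableProb
    exact eventProb_le_one _ hy0 hy1
  have h0 : Tendsto (fun L => erasureFamily L (1 - y)) atTop (𝓝 0) :=
    erasureThreshold_half (1 - y) (by linarith) (by linarith)
  have h1 : Tendsto (fun L => 1 - erasureFamily L (1 - y)) atTop (𝓝 1) := by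
    simpa using h0.const_sub 1
  exact tendsto_of_tendsto_of_tendsto_of_le_of_le h1 tendsto_const_nhds hlow hup

/-- **Decoder form**: for EVERY family of consistent loss decoders of the toric codes (maximum-likelihood loss decoding,
Delfosse–Zémor's linear-time peeling decoder, …) the probability that the random loss pattern admits an error on which
the decoder fails tends to `0` for every loss rate `y < 1/2`. [cite: DelfosseZemor2020, §2 (ML decoding for qubit loss; Lemma 1)] -/
theorem erasureDecoderThreshold_half (D : (L : ℕ) → ErasureDecoder (Edge (L + 1)) (Syndrome (L + 1)))
    (hD : ∀ L, (D L).IsConsistent (syn (L + 1)) (cycles (L + 1))) :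
    IsThresholdLowerBound (fun L y => (D L).failureProb (syn (L + 1)) (boundaries (L + 1)) y) (1 / 2) := by
  intro y hy0 hy
  have hy1 : y ≤ 1 := by linarith
  have h := erasureThreshold_half y hy0 hy
  exact BelowThreshold.of_le (P := fun L y => (D L).failureProb (syn (L + 1)) (boundaries (L + 1)) y) h
    (fun L => ErasureDecoder.failureProb_nonneg _ _ _ hy0 hy1)
    (fun L => ErasureDecoder.failureProb_le_uncorrectableProb (hD L) _ hy0 hy1)

/-- **Every loss-decoder family of the toric codes has loss threshold `≤ 1/2`** (consistent or not): a decoder fails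
on every uncorrectable loss pattern (`uncorrectableProb_le_failureProb`), and at loss rate `1/2` those have probability
`≥ 1/2` (`half_le_uncorrectableProb_half`). [cite: StaceBarrettDoherty2009, p. 1–2 (maximum tolerable loss rate 50%)] -/
theorem erasureDecoder_threshold_le_half (D : (L : ℕ) → ErasureDecoder (Edge (L + 1)) (Syndrome (L + 1))) {a : ℝ}
    (ha : IsThresholdLowerBound (fun L y => (D L).failureProb (syn (L + 1)) (boundaries (L + 1)) y) a) :
    a ≤ 1 / 2 := by
  by_contra h
  push Not at h
  refine not_belowThreshold_of_le (c := 1 / 2) (by norm_num) (fun L => ?_) (ha (1 / 2) (by norm_num) h)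
  calc (1 / 2 : ℝ) ≤ ErasureDecoder.uncorrectableProb (cycles (L + 1)) (boundaries (L + 1)) (1 / 2) :=
        half_le_uncorrectableProb_half
    _ ≤ (D L).failureProb (syn (L + 1)) (boundaries (L + 1)) (1 / 2) :=
        ErasureDecoder.uncorrectableProb_le_failureProb (D L) (rowSpace (plaquetteMatrix (L + 1)))
          (fun x hx => by rw [show syn (L + 1) x = 0 from hx]; unfold syn; rw [Matrix.mulVec_zero])
          (by norm_num) (by norm_num)

/-- **Exact decoder threshold**: EVERY family of consistent loss decoders of the toric codes (maximum likelihood, peeling,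
the canonical any-consistent-chain decoder `canonical_isConsistent_toric`, …) has loss accuracy threshold EXACTLY `1/2`.
[cite: StaceBarrettDoherty2009, p. 1 (abstract); DelfosseZemor2020, Lemma 1] -/
theorem erasureDecoder_accuracyThreshold_eq_half (D : (L : ℕ) → ErasureDecoder (Edge (L + 1)) (Syndrome (L + 1)))
    (hD : ∀ L, (D L).IsConsistent (syn (L + 1)) (cycles (L + 1))) :
    accuracyThreshold (fun L y => (D L).failureProb (syn (L + 1)) (boundaries (L + 1)) y) = 1 / 2 :=
  le_antisymm (erasureDecoder_threshold_le_half D (isThresholdLowerBound_accuracyThreshold _))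
    (le_accuracyThreshold (erasureDecoderThreshold_half D hD) (by norm_num))

/-! ### Appended (qec-type-03 gen 5): exponential decay below `1/2`; beyond loss rate `1/2` no flip rate is
tolerable for any decoder -/

/-- **Exponential decay below the loss threshold**: for every loss rate `0 ≤ y < 1/2` there are `C` and `r < 1` with
`P_y[loss pattern of the (L+1) × (L+1) toric code uncorrectable] ≤ C r^L` for all `L` (from the bound
`(L+1)² e^{-c⌊L/2⌋}` of `erasureThreshold_half`; Kesten 1980 Thm. 2 (1.7)). [cite: KestenCMP1980, Thm. 2 (1.7)] [cite: StaceBarrettDoherty2009, p. 2–3] -/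
theorem erasureFamily_decaysExponentially {y : ℝ} (hy0 : 0 ≤ y) (hy : y < 1 / 2) :
    DecaysExponentially erasureFamily y := by
  have hy1 : y ≤ 1 := by linarith
  set p : unitInterval := ⟨y, hy0, hy1⟩ with hp
  obtain ⟨c, hc, hdec⟩ := Kesten1980_expDecay p (by simpa [hp] using hy)
  have hnonneg : ∀ L : ℕ, 0 ≤ erasureFamily L y := fun L =>
    ErasureDecoder.uncorrectableProb_nonneg _ _ hy0 hy1
  -- the auxiliary sequence `(L+1)² e^{-(c/4)L}` tends to `0`, hence is bounded by some `M`
  have hc4 : 0 < c / 4 := by linarith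
  have haux : Tendsto (fun L : ℕ => Real.exp (c / 4) * ((L + 1 : ℕ) : ℝ) ^ 2 *
      Real.exp (-(c / 4 * ((((L + 1 : ℕ) : ℝ)) - 1)))) atTop (𝓝 0) :=
    (Filter.tendsto_add_atTop_iff_nat 1).2 (tendsto_const_mul_sq_mul_exp_neg (Real.exp (c / 4)) (c / 4) hc4)
  obtain ⟨M, hM⟩ := haux.bddAbove_range
  have hMnonneg : 0 ≤ M := le_trans (by positivity) (hM ⟨0, rfl⟩)
  set r : ℝ := Real.exp (-(c / 4)) with hr
  have hr0 : 0 < r := Real.exp_pos _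
  have hr1 : r < 1 := Real.exp_lt_one_iff.2 (by linarith)
  refine ⟨Real.exp (c / 2) * M + r⁻¹, r, hr0.le, hr1, fun L => ?_⟩
  rw [abs_of_nonneg (hnonneg L)]
  have hrL : r ^ L = Real.exp (-(c / 4) * L) := by
    rw [hr, ← Real.exp_nat_mul]; ring_nf
  rcases lt_or_ge L 2 with hL | hL
  · -- small sizes: the probability is at most `1 ≤ r⁻¹ r^L`
    have h1 : erasureFamily L y ≤ 1 := by
      classical
      unfold erasureFamily ErasureDecoder.uncorrectableProb
      exact eventProb_le_one _ hy0 hy1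
    have h2 : (1 : ℝ) ≤ r⁻¹ * r ^ L := by
      interval_cases L
      · rw [pow_zero, mul_one]
        exact (one_le_inv₀ hr0).2 hr1.le
      · rw [pow_one, inv_mul_cancel₀ hr0.ne']
    calc erasureFamily L y ≤ 1 := h1
      _ ≤ r⁻¹ * r ^ L := h2
      _ ≤ (Real.exp (c / 2) * M + r⁻¹) * r ^ L := by
          have : 0 ≤ Real.exp (c / 2) * M * r ^ L := by positivity
          nlinarith
  · -- `L ≥ 2`: `P ≤ (L+1)² e^{-c⌊L/2⌋} ≤ e^{c/2} (L+1)² e^{-(c/2)L} = e^{c/2} [(L+1)² e^{-(c/4)L}] e^{-(c/4)L}`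
    have hb := uncorrectableProb_le_sq_mul_real_siteToBoundary (L := L + 1) (by omega) (n := L / 2) (by omega) p
    have hfloor : ((L : ℝ) - 1) / 2 ≤ ((L / 2 : ℕ) : ℝ) := by
      have h1 : (L : ℝ) - 1 ≤ 2 * ((L / 2 : ℕ) : ℝ) := by
        have : L - 1 ≤ 2 * (L / 2) := by omega
        have : ((L - 1 : ℕ) : ℝ) ≤ ((2 * (L / 2) : ℕ) : ℝ) := by exact_mod_cast this
        rw [Nat.cast_sub (by omega)] at this
        push_cast at this
        linarith
      linarith
    have hexp : Real.exp (-c * (L / 2 : ℕ)) ≤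
        Real.exp (c / 2) * Real.exp (-(c / 4 * ((((L + 1 : ℕ) : ℝ)) - 1))) * Real.exp (-(c / 4) * L) := by
      rw [← Real.exp_add, ← Real.exp_add]
      apply Real.exp_le_exp.2
      push_cast
      nlinarith
    have hM' : Real.exp (c / 4) * ((L + 1 : ℕ) : ℝ) ^ 2 * Real.exp (-(c / 4 * ((((L + 1 : ℕ) : ℝ)) - 1))) ≤ M :=
      hM ⟨L, rfl⟩
    have hkey : ((L + 1 : ℕ) : ℝ) ^ 2 * Real.exp (-c * (L / 2 : ℕ)) ≤ Real.exp (c / 2) * M * r ^ L := by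
      calc ((L + 1 : ℕ) : ℝ) ^ 2 * Real.exp (-c * (L / 2 : ℕ))
          ≤ ((L + 1 : ℕ) : ℝ) ^ 2 * (Real.exp (c / 2) * Real.exp (-(c / 4 * ((((L + 1 : ℕ) : ℝ)) - 1))) *
              Real.exp (-(c / 4) * L)) := mul_le_mul_of_nonneg_left hexp (by positivity)
        _ = Real.exp (c / 2) * Real.exp (-(c / 4)) *
              (Real.exp (c / 4) * ((L + 1 : ℕ) : ℝ) ^ 2 * Real.exp (-(c / 4 * ((((L + 1 : ℕ) : ℝ)) - 1)))) *
              Real.exp (-(c / 4) * L) := by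
            have : Real.exp (-(c / 4)) * Real.exp (c / 4) = 1 := by
              rw [← Real.exp_add]; simp
            calc ((L + 1 : ℕ) : ℝ) ^ 2 * (Real.exp (c / 2) * Real.exp (-(c / 4 * ((((L + 1 : ℕ) : ℝ)) - 1))) *
                  Real.exp (-(c / 4) * L))
                = Real.exp (c / 2) * (Real.exp (-(c / 4)) * Real.exp (c / 4)) *
                    (((L + 1 : ℕ) : ℝ) ^ 2 * Real.exp (-(c / 4 * ((((L + 1 : ℕ) : ℝ)) - 1)))) *
                    Real.exp (-(c / 4) * L) := by rw [this]; ring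
              _ = _ := by ring
        _ ≤ Real.exp (c / 2) * Real.exp (-(c / 4)) * M * Real.exp (-(c / 4) * L) := by
            have h0 : 0 ≤ Real.exp (c / 2) * Real.exp (-(c / 4)) := by positivity
            have h1 : 0 ≤ Real.exp (-(c / 4) * L) := by positivity
            nlinarith [mul_le_mul_of_nonneg_left hM' h0]
        _ ≤ Real.exp (c / 2) * M * r ^ L := by
            rw [hrL]
            have h1 : Real.exp (-(c / 4)) ≤ 1 := Real.exp_le_one_iff.2 (by linarith)
            have h2 : 0 ≤ Real.exp (c / 2) * M * Real.exp (-(c / 4) * L) := by positivity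
            nlinarith
    calc erasureFamily L y ≤ ((L + 1 : ℕ) : ℝ) ^ 2 * (bondPercolation (zdGraph 2) p).real (siteToBoundary 2 (L / 2)) := hb
      _ ≤ ((L + 1 : ℕ) : ℝ) ^ 2 * Real.exp (-c * (L / 2 : ℕ)) := mul_le_mul_of_nonneg_left (hdec _) (by positivity)
      _ ≤ Real.exp (c / 2) * M * r ^ L := hkey
      _ ≤ (Real.exp (c / 2) * M + r⁻¹) * r ^ L := by
          have : 0 ≤ r⁻¹ * r ^ L := by positivity
          nlinarith

/-- **Beyond loss rate `1/2` no flip rate is tolerable, for ANY decoder**: for `1/2 ≤ y ≤ 1` and every family `D` of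
erasure-aware decoders of the toric codes, the flip-rate accuracy threshold of the loss–error family `mixedFamily D y`
(losses `y`, independent flips `p`) is `0` — the right edge of Stace–Barrett–Doherty's phase diagram. (Flips at any rate
`p > 0` are extra erasures filled with coins, `uncorrectableProb_le_two_mul_mixedFailureProb`; the total loss rate
`y + 2p(1-y) > 1/2` is supercritical, `tendsto_erasureFamily_one`.) [cite: StaceBarrettDoherty2009, p. 2–3 and Fig. 2 (the correctable region ends at p_loss = 0.5)] -/
theorem mixed_accuracyThreshold_eq_zero (D : (L : ℕ) → ErasureDecoder (Edge (L + 1)) (Syndrome (L + 1))) {y : ℝ}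
    (hy : 1 / 2 ≤ y) (hy1 : y ≤ 1) : accuracyThreshold (mixedFamily D y) = 0 := by
  refine le_antisymm ?_ (accuracyThreshold_nonneg _)
  by_contra hpos
  push Not at hpos
  set a := accuracyThreshold (mixedFamily D y) with ha
  -- a flip rate `0 < q < a`, `q ≤ 1/2`
  set q : ℝ := min (a / 2) (1 / 2) with hq
  have hq0 : 0 < q := lt_min (by linarith) (by norm_num)
  have hqa : q < a := lt_of_le_of_lt (min_le_left _ _) (by linarith)
  have hq2 : q ≤ 1 / 2 := min_le_right _ _
  have hbelow : BelowThreshold (mixedFamily D y) q :=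
    belowThreshold_of_lt_accuracyThreshold hq0.le hqa
  -- the total loss rate `y' = y + 2q(1-y)` is supercritical (or `y = 1`)
  set y' : ℝ := y + (1 - y) * (2 * q) with hy'
  have hy'gt : 1 / 2 < y' := by
    rcases eq_or_lt_of_le hy1 with h1 | h1
    · rw [hy', h1]; norm_num
    · have : 0 < (1 - y) * (2 * q) := mul_pos (by linarith) (by linarith)
      linarith
  have hy'le : y' ≤ 1 := by
    have : (1 - y) * (2 * q) ≤ (1 - y) * 1 := mul_le_mul_of_nonneg_left (by linarith) (by linarith)
    linarith
  have hone := tendsto_erasureFamily_one hy'gt hy'le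
  have hle : ∀ L : ℕ, (1 / 2 : ℝ) * erasureFamily L y' ≤ mixedFamily D y L q := by
    intro L
    have h := uncorrectableProb_le_two_mul_mixedFailureProb (starMatrix (L + 1)) (rowSpace (plaquetteMatrix (L + 1)))
      (D L) (y := y) (p := q) (by linarith) hy1 hq0.le hq2
    change erasureFamily L y' ≤ 2 * mixedFamily D y L q at h
    linarith
  have hlim : (1 / 2 : ℝ) * 1 ≤ 0 :=
    le_of_tendsto_of_tendsto' (hone.const_mul (1 / 2)) hbelow hle
  linarith

end ToricCode

end Literature.InformationTheory.QuantumCodes
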